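import Literature.NumberTheory.EllipticCurves.Rank1Residual.X9TrivialPartner
import Literature.NumberTheory.EllipticCurves.PointCountEulerCriterion
import Summits.BirchSwinnertonDyer.BirchSwinnertonDyer.Theorems.Rank1ResidualX11RankOneReduction
import Summits.BirchSwinnertonDyer.BirchSwinnertonDyer.Theorems.Rank1ResidualX1Defs
import Summits.BirchSwinnertonDyer.Rank1Residual.X11b.ChaPairsMinimality
import HarnessLib

/-!
# Class X10b (N2), the UNIT ROAD at `p = 3`: Mazur's main conjecture WITH `μ = 0` AT THE PAIR for
# the N2 cells with trivial `3`-primary arithmetic, and for every N2 cell congruent to such a curve —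
# Greenberg–Vatsal-, Rubin-, Yan–Zhu- and certificate-`μ`-FREE (cell `b2b-bsdres`, unit
# `b2b-bsdres-x10` = N2 class lead, gen 24)

HONEST FRAMING (run/shared/lean/b2b/bsd-rank1-residual/, verbatim in every file): the goal of the
cell is to DELETE the COMBINATION-SHAPED residual classes of the Birch–Swinnerton-Dyer formula for
ALL analytic-rank `≤ 1` elliptic curves over `ℚ` — "full BSD formula for every rank `≤ 1` curve in
class `C`" assembled STRICTLY from published theorems — so that the rank-`≤ 1` remainder becomes
exactly the CONSTRUCTION-SHAPED classes, which are TYPED (missing-input `Prop`s), NOT attempted.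
This is not "finishing BSD". Theorems only; NO definition, NO named fact is introduced; class X10b
(`p = 3` good ordinary, `E[3]` irreducible, `ρ̄_{E,3}` onto a Cartan normaliser) keeps its label
CONSTRUCTION-SHAPED (NEEDS X_A3 = `MazurMainConjecture W 3`, referee R82.3 / RESIDUAL-MAP §I N2);
nothing is booked by this file; everything is PER PAIR.

## What this file adds (composition; the class lead's λ-SUBPARTITION of N2, `class-closure/N2/LAMBDA-SUBPARTITION-x10g24.md`)

The N2 records of gens 19–23 inhabit the class's typed target X_A3 AT THE PAIR only on the 94 K-CM
cells (Rubin 1991 ∘ Greenberg–Vatsal 2000, with ONE analytic certificate `hC2` = a unit coefficient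
of the CM partner's `3`-adic `L`-function). The x9 seat's route U2 at an ODD prime
(`Rank1Residual.mazurMainConjecture_with_mu_zero_of_trivialArithmetic_odd`, gen 5: Kato 2004
Thm. 17.4 (1) `hkato`, Greenberg 1999 Thm. 4.1 `hGr`, the period unit `h5`/`h3`; NO Greenberg–Vatsal,
NO Rubin, NO Yan–Zhu, NO `μ`-certificate) says: a curve `A` good ordinary and NON-ANOMALOUS at `3`
with `A[3]` irreducible, `3 ∤ ∏ c_ℓ(A)`, `ord_3 (L(A,1)/Ω_A) = 0` and `Sel_{3^∞}(A/ℚ) = 0` satisfies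
Mazur's main conjecture at `3` TRIVIALLY — in the proof both sides are units of `Λ` (`X(A/ℚ_∞)` has
unit characteristic power series, `ϖ·L_3(f_A, α) ∈ Λ^×`); the exported statement is the cell's
`μ = 0` (unit-content) form. The x9 file records (docstring of
`norm_periodRatio_eq_one_of_odd`) that this serves class X10b, and proves `BSD(E,3)` consequences
(`X10b.bsdp_of_trivialPartner`); the `MazurMainConjecture`-valued consequences for N2 were never
instantiated. THIS FILE = the integer-model consumers the N2 per-pair records instantiate (pattern of
`X10/CMPartnerTransport.lean`), every reduction / image hypothesis READ OFF the literal model: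

* §1 `mazurMainConjecture_three_unitContent_of_ainvs_of_trivialArithmetic` /
  `mazurMainConjecture_three_of_ainvs_of_trivialArithmetic` — the UNIT ROAD: target `W`
  (`integralModelInt W = [a₁,…,a₆]`), `3 ∤ Δ`, `#W̃(𝔽₃) = n₃` with `3 ∤ 4 − n₃` (ordinary) AND
  `3 ∤ n₃` (non-anomalous), a good prime `ℓ ≠ 3` with `#W̃(𝔽_ℓ) = n` and `X² − (ℓ+1−n)X + ℓ`
  root-free mod `3` (`E[3]` irreducible, Mazur 1978 Prop. 6.3 (1)); census binders `htam`
  (`3 ∤ ∏ c_ℓ`), `hL` (`L(E,1)/Ω_E` a nonzero rational `3`-adic unit), `hSel` (`#Sel_{3^∞}(E/ℚ) = 1`);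
  PUBLISHED `hkato`, `hGr`, `h5`, `h3`. Output: Mazur's statement at `(E,3)` with a generator of
  UNIT CONTENT, hence `MazurMainConjecture W 3` (X_A3 at the pair).
* §2 `mazurMainConjecture_three_unitContent_of_ainvs_of_trivialPartner` /
  `mazurMainConjecture_three_of_ainvs_of_trivialPartner` — the TRIVIAL-PARTNER ROAD: target `W` any N2
  cell (good ordinary at `3`, `E[3]` irreducible, ANY rank, ANY Tamagawa numbers / `Ш`), partner `A`
  (`[b₁,…,b₆]`) as in §1, C1 (`hC1`: a `Γ_ℚ`-equivariant `A[3] ≃ E[3]`), PUBLISHED Greenberg–Vatsal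
  2000 Thm. (1.4) (`hGV`) on top of §1's facts. Output: `MazurMainConjecture W 3` with unit content.
The per-pair UNIT records (first the `3Nn` cells — the image type with NO CM road, x10 gen 20
X10-AUDIT §26 Lemma (L5) — then the `3Ns` cells outside K-CM) are the sibling files
`X10/UnitRoadRecords*.lean`, which consume §1 BY NAME.

Census behind the choice (E2 table `class-closure/N2/E2-hypotheses.tsv` b375f8b1f4f669b0, 313 cells
of record): analytic rank `0`: 274 = 128 ANOMALOUS (`a₃ ≡ 1 (mod 3)`) + 146 non-anomalous; rank `1`:
39 = 10 + 29; UNIT cells (rank `0`, non-anomalous, `3 ∤ ∏c_ℓ`, `3 ∤ #Ш_an`) = 77 (3Ns 42 / 3Nn 35;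
8 of them K-CM). `a₃ mod 3` is an invariant of `ρ̄_{E,3}` (trace of Frobenius on the unramified
quotient at a good ordinary odd `p`), so NO anomalous cell has a non-anomalous partner: on the 102
anomalous non-K-CM cells X_A3 is open EVEN AT THE PAIR (there the interpolation factor `(1 − α⁻¹)²`
of `L_3(E,0)` is a non-unit, `α ≡ a₃ ≡ 1`, so the main conjecture is not a triviality).
Per pair; no class statement; nothing booked; N2 mark unchanged.

References: K. Kato, Astérisque 295 (2004) Thm. 17.4 (1) [Kato2004Asterisque]; R. Greenberg, LNM
1716 (1999) Thm. 4.1, Prop. 3.8 [GreenbergLNM1716]; R. Greenberg, V. Vatsal, Invent. Math. 142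
(2000) Thm. (1.4), §3 Remark (3.4) [GreenbergVatsal2000]; B. Mazur, Invent. Math. 44 (1978) Prop.
6.3 (1), Cor. 4.1 [Mazur1978]; J. E. Cremona, *Algorithms for Modular Elliptic Curves* (tables)
[Cremona2006]; cell files X10-AUDIT.md §30, `class-closure/N2/LAMBDA-SUBPARTITION-x10g24.md`.
-/

set_option autoImplicit false

noncomputable section

open scoped Classical MatrixGroups ModularForm

open CongruenceSubgroup WeierstrassCurve Literature.NumberTheory.EllipticCurves
  Literature.NumberTheory.EllipticCurves.ModularForms Literature.NumberTheory.EllipticCurves.Rank1Residual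
  Literature.NumberTheory.EllipticCurves.Rank1Residual.X11RankOneCertificates
  Summit.BirchSwinnertonDyer.BirchSwinnertonDyer.Rank1Residual.IntModel
  Summit.BirchSwinnertonDyer.BirchSwinnertonDyer.Rank1Residual.X11RankOne
  Summit.BirchSwinnertonDyer.BirchSwinnertonDyer.Theorems.Rank1ResidualX1Defs
  Summit.BirchSwinnertonDyer.Rank1Residual.X11b

namespace Summit.BirchSwinnertonDyer.Rank1Residual.X10.UnitRoad

/-! ### §1. The UNIT ROAD: trivial `3`-primary arithmetic of the cell itself -/

/-- **Mazur's main conjecture at `(E,3)` WITH `μ = 0`, for a cell with trivial `3`-primary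
arithmetic given by a literal integer model.** Target `W` (integral model `[a₁,…,a₆]`): `3 ∤ Δ`
(good at `3`), `#W̃(𝔽₃) = n₃` with `3 ∤ 4 − n₃` (ordinary: `a₃ = 4 − n₃`) and `3 ∤ n₃`
(non-anomalous), a good prime `ℓ ≠ 3` with `#W̃(𝔽_ℓ) = n` and `X² − (ℓ+1−n)X + ℓ` root-free mod `3`
(`E[3]` irreducible, Mazur 1978 Prop. 6.3 (1)); census binders `htam : 3 ∤ ∏ c_ℓ(E)`,
`hL : L(E,1)/Ω_E ∈ ℚ^×` a `3`-adic unit, `hSel : #Sel_{3^∞}(E/ℚ) = 1`; PUBLISHED named facts Kato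
2004 Thm. 17.4 (1) (`hkato`), Greenberg 1999 Thm. 4.1 (`hGr`), the period unit (`h5`, `h3`).
Conclusion: for the cyclotomic data, the newform `f` of `E`, `ϖ·Ω_E = Ω⁺_f` and every dual datum,
`X(E/ℚ_∞)` is `Λ`-torsion and `char_Λ X = (g)` with `HasUnitContent g` and `ι g = ϖ·L₃(f, α)`.
One-line instance of `Rank1Residual.mazurMainConjecture_with_mu_zero_of_trivialArithmetic_odd`
(x9 gen 5). Per pair; no class statement; nothing booked.
[cite: Kato2004Asterisque, Thm. 17.4 (1) (p. 273)] [cite: GreenbergLNM1716, Thm. 4.1 (p. 102) and Prop. 3.8 (p. 95)]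
[cite: Mazur1978, §6 Prop. 6.3 (1) (p. 153)] -/
theorem mazurMainConjecture_three_unitContent_of_ainvs_of_trivialArithmetic
    (hkato : ∀ (W : WeierstrassCurve ℚ) [W.IsElliptic] [W.IsGloballyMinimal] (p : ℕ) [Fact p.Prime]
      (κ : ZpExtension ℚ p) (γ : Field.absoluteGaloisGroup ℚ) (N : ℕ) [NeZero N]
      (f : CuspForm (Gamma0 N) 2), kato_divisibility W p (κ := κ) (γ := γ) (f := f))
    (hGr : greenberg_charValue_rankZero) (h5 : realPeriodRat_eq_unit_mul_plusPeriod)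
    (h3 : realPeriodRat_eq_unit_mul_plusPeriod_three)
    (a1 a2 a3 a4 a6 : ℤ) {W : WeierstrassCurve ℚ} [W.IsElliptic] [W.IsGloballyMinimal]
    (hW : integralModelInt W = ⟨a1, a2, a3, a4, a6⟩)
    [Fact (Nat.Prime 3)] (ℓ n n3 : ℕ) [Fact ℓ.Prime]
    (h3Δ : ¬ (3 : ℤ) ∣ discOf [a1, a2, a3, a4, a6])
    (hcard3 : Nat.card (((⟨a1, a2, a3, a4, a6⟩ : WeierstrassCurve ℤ).map
      (Int.castRingHom (ZMod 3))).toAffine.Point) = n3)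
    (hord3 : ¬ (3 : ℤ) ∣ (3 : ℤ) + 1 - n3) (hna3 : ¬ 3 ∣ n3)
    (hℓ3 : ℓ ≠ 3) (hℓΔ : ¬ (ℓ : ℤ) ∣ discOf [a1, a2, a3, a4, a6])
    (hcard : Nat.card (((⟨a1, a2, a3, a4, a6⟩ : WeierstrassCurve ℤ).map
      (Int.castRingHom (ZMod ℓ))).toAffine.Point) = n)
    (hnoroot : ∀ t : ℕ, t < 3 → ¬ (3 : ℤ) ∣ (t : ℤ) ^ 2 - ((ℓ : ℤ) + 1 - n) * t + ℓ)
    (htam : ¬ 3 ∣ W.tamagawaProduct)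
    (hL : ∃ q : ℚ, q ≠ 0 ∧ W.entireLFunction 1 / (W.realPeriodRat : ℂ) = (q : ℂ) ∧ padicValRat 3 q = 0)
    (hSel : Nat.card (W.selmerGroupPInfty 3) = 1) :
    ∀ (κ : ZpExtension ℚ 3) (γ : Field.absoluteGaloisGroup ℚ),
        κ.IsCyclotomic → κ.IsTopGenerator γ → IsCyclotomicVariable 3 γ →
      ∀ [NeZero (W.conductorNorm ℤ)] (f : CuspForm (Gamma0 (W.conductorNorm ℤ)) 2),
        IsNewformOf W f → ∀ (ϖ : ℚ), (ϖ : ℝ) * W.realPeriodRat = plusPeriod f →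
      ∀ (D : W.SelmerDualData κ γ), D.IsTorsion ∧
        ∃ g : IwasawaAlgebra 3, D.charIdeal = Ideal.span {g} ∧
          GreenbergVatsal2000.HasUnitContent g ∧
          iwasawaToPowerSeries 3 g =
            PowerSeries.C (ϖ : ℚ_[3]) * padicLFunction f (unitRoot W 3 : ℚ_[3]) := by
  have hΔ : (⟨a1, a2, a3, a4, a6⟩ : WeierstrassCurve ℤ).Δ = discOf [a1, a2, a3, a4, a6] :=
    intCurve_Δ a1 a2 a3 a4 a6
  have hgood : W.HasGoodReductionAtPrime 3 :=
    hasGoodReductionAtPrime_of_not_dvd W 3 (by rw [minimalDiscriminantInt_eq hW, hΔ]; exact h3Δ)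
  have hord : ¬ ((3 : ℕ) : ℤ) ∣ W.frobeniusTrace 3 := by
    rw [frobeniusTrace_eq hW hcard3]; exact hord3
  have hna : ¬ 3 ∣ W.reductionPointCount 3 := by
    rw [WeierstrassCurve.reductionPointCount, hW, hcard3]; exact hna3
  have hirr : W.HasIrreducibleModPGaloisRep 3 := by
    refine hasIrreducibleModPGaloisRep_of_intModel_of_noroot hW 3 ℓ hℓ3 (by rw [hΔ]; exact hℓΔ) hcard
      (forall_zmod_of_forall_lt fun t ht h0 ↦ hnoroot t ht ?_)
    change ((3 : ℕ) : ℤ) ∣ _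
    rw [← ZMod.intCast_zmod_eq_zero_iff_dvd]
    push_cast at h0 ⊢
    linear_combination h0
  exact mazurMainConjecture_with_mu_zero_of_trivialArithmetic_odd hkato hGr h5 h3 W 3 (by decide)
    hgood hord hirr hna htam hL hSel

/-- **Hence the cell's typed missing input X_A3 at the pair: `MazurMainConjecture W 3`** (the statement
of `Rank1ResidualX1Defs`; the unit-content clause dropped), for a cell with trivial `3`-primary
arithmetic. Same hypotheses; per pair; nothing booked. [cite: Kato2004Asterisque, Thm. 17.4 (1) (p. 273)]
[cite: GreenbergLNM1716, Thm. 4.1 (p. 102) and Prop. 3.8 (p. 95)] [cite: CastellaGrossiSkinner2025, Introduction (MC)] -/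
theorem mazurMainConjecture_three_of_ainvs_of_trivialArithmetic
    (hkato : ∀ (W : WeierstrassCurve ℚ) [W.IsElliptic] [W.IsGloballyMinimal] (p : ℕ) [Fact p.Prime]
      (κ : ZpExtension ℚ p) (γ : Field.absoluteGaloisGroup ℚ) (N : ℕ) [NeZero N]
      (f : CuspForm (Gamma0 N) 2), kato_divisibility W p (κ := κ) (γ := γ) (f := f))
    (hGr : greenberg_charValue_rankZero) (h5 : realPeriodRat_eq_unit_mul_plusPeriod)
    (h3 : realPeriodRat_eq_unit_mul_plusPeriod_three)
    (a1 a2 a3 a4 a6 : ℤ) {W : WeierstrassCurve ℚ} [W.IsElliptic] [W.IsGloballyMinimal]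
    (hW : integralModelInt W = ⟨a1, a2, a3, a4, a6⟩)
    [Fact (Nat.Prime 3)] (ℓ n n3 : ℕ) [Fact ℓ.Prime]
    (h3Δ : ¬ (3 : ℤ) ∣ discOf [a1, a2, a3, a4, a6])
    (hcard3 : Nat.card (((⟨a1, a2, a3, a4, a6⟩ : WeierstrassCurve ℤ).map
      (Int.castRingHom (ZMod 3))).toAffine.Point) = n3)
    (hord3 : ¬ (3 : ℤ) ∣ (3 : ℤ) + 1 - n3) (hna3 : ¬ 3 ∣ n3)
    (hℓ3 : ℓ ≠ 3) (hℓΔ : ¬ (ℓ : ℤ) ∣ discOf [a1, a2, a3, a4, a6])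
    (hcard : Nat.card (((⟨a1, a2, a3, a4, a6⟩ : WeierstrassCurve ℤ).map
      (Int.castRingHom (ZMod ℓ))).toAffine.Point) = n)
    (hnoroot : ∀ t : ℕ, t < 3 → ¬ (3 : ℤ) ∣ (t : ℤ) ^ 2 - ((ℓ : ℤ) + 1 - n) * t + ℓ)
    (htam : ¬ 3 ∣ W.tamagawaProduct)
    (hL : ∃ q : ℚ, q ≠ 0 ∧ W.entireLFunction 1 / (W.realPeriodRat : ℂ) = (q : ℂ) ∧ padicValRat 3 q = 0)
    (hSel : Nat.card (W.selmerGroupPInfty 3) = 1) :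
    MazurMainConjecture W 3 := by
  intro κ γ hκ hγ hγ' _ f hf ϖ hϖ D
  obtain ⟨hT, g, hg, -, hι⟩ := mazurMainConjecture_three_unitContent_of_ainvs_of_trivialArithmetic
    hkato hGr h5 h3 a1 a2 a3 a4 a6 hW ℓ n n3 h3Δ hcard3 hord3 hna3 hℓ3 hℓΔ hcard hnoroot htam hL hSel
    κ γ hκ hγ hγ' f hf ϖ hϖ D
  exact ⟨hT, g, hg, hι⟩

/-! ### §2. The TRIVIAL-PARTNER ROAD: a congruent curve with trivial `3`-primary arithmetic -/

/-- **Mazur's main conjecture at `(E,3)` WITH `μ = 0`, for ANY cell (any rank, any Tamagawa numbers,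
any `Ш`) congruent mod `3` to a curve with trivial `3`-primary arithmetic.** Target `W`
(`[a₁,…,a₆]`): `3 ∤ Δ`, `#W̃(𝔽₃) = n₃` with `3 ∤ 4 − n₃` (good ordinary), a good `ℓ ≠ 3` with
`#W̃(𝔽_ℓ) = n`, `X² − (ℓ+1−n)X + ℓ` root-free mod `3` (`E[3]` irreducible); partner `A`
(`[b₁,…,b₆]`): `3 ∤ Δ_A`, `#Ã(𝔽₃) = m₃` with `3 ∤ 4 − m₃` and `3 ∤ m₃`, census binders `htamA`,
`hLA`, `hSelA` as in §1; certificate C1 (`hC1`: a `Γ_ℚ`-equivariant `A[3] ≃ E[3]`; the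
irreducibility of `A[3]` is that of `E[3]` along C1). PUBLISHED `hkato`, `hGr`, `h5`, `h3` and
Greenberg–Vatsal 2000 Thm. (1.4) (`hGV`). Conclusion: Mazur's statement at `(E,3)` with a generator
of UNIT CONTENT: §1 for `A`, transported along C1 by `hGV`. Per pair; nothing booked.
[cite: GreenbergVatsal2000, Thm. (1.4) (arXiv p. 5)] [cite: Kato2004Asterisque, Thm. 17.4 (1) (p. 273)]
[cite: GreenbergLNM1716, Thm. 4.1 (p. 102) and Prop. 3.8 (p. 95)] [cite: Mazur1978, §6 Prop. 6.3 (1) (p. 153)] -/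
theorem mazurMainConjecture_three_unitContent_of_ainvs_of_trivialPartner
    (hkato : ∀ (W : WeierstrassCurve ℚ) [W.IsElliptic] [W.IsGloballyMinimal] (p : ℕ) [Fact p.Prime]
      (κ : ZpExtension ℚ p) (γ : Field.absoluteGaloisGroup ℚ) (N : ℕ) [NeZero N]
      (f : CuspForm (Gamma0 N) 2), kato_divisibility W p (κ := κ) (γ := γ) (f := f))
    (hGr : greenberg_charValue_rankZero) (h5 : realPeriodRat_eq_unit_mul_plusPeriod)
    (h3 : realPeriodRat_eq_unit_mul_plusPeriod_three)
    (hGV : GreenbergVatsal2000.thm14_mainConjecture_transfer_of_torsionIso)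
    (a1 a2 a3 a4 a6 : ℤ) {W : WeierstrassCurve ℚ} [W.IsElliptic] [W.IsGloballyMinimal]
    (hW : integralModelInt W = ⟨a1, a2, a3, a4, a6⟩)
    (b1 b2 b3 b4 b6 : ℤ) {A : WeierstrassCurve ℚ} [A.IsElliptic] [A.IsGloballyMinimal]
    (hA : integralModelInt A = ⟨b1, b2, b3, b4, b6⟩)
    [Fact (Nat.Prime 3)] (ℓ n n3 m3 : ℕ) [Fact ℓ.Prime]
    (h3Δ : ¬ (3 : ℤ) ∣ discOf [a1, a2, a3, a4, a6])
    (hcard3 : Nat.card (((⟨a1, a2, a3, a4, a6⟩ : WeierstrassCurve ℤ).map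
      (Int.castRingHom (ZMod 3))).toAffine.Point) = n3)
    (hord3 : ¬ (3 : ℤ) ∣ (3 : ℤ) + 1 - n3)
    (hℓ3 : ℓ ≠ 3) (hℓΔ : ¬ (ℓ : ℤ) ∣ discOf [a1, a2, a3, a4, a6])
    (hcard : Nat.card (((⟨a1, a2, a3, a4, a6⟩ : WeierstrassCurve ℤ).map
      (Int.castRingHom (ZMod ℓ))).toAffine.Point) = n)
    (hnoroot : ∀ t : ℕ, t < 3 → ¬ (3 : ℤ) ∣ (t : ℤ) ^ 2 - ((ℓ : ℤ) + 1 - n) * t + ℓ)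
    (h3ΔA : ¬ (3 : ℤ) ∣ discOf [b1, b2, b3, b4, b6])
    (hcard3A : Nat.card (((⟨b1, b2, b3, b4, b6⟩ : WeierstrassCurve ℤ).map
      (Int.castRingHom (ZMod 3))).toAffine.Point) = m3)
    (hord3A : ¬ (3 : ℤ) ∣ (3 : ℤ) + 1 - m3) (hna3A : ¬ 3 ∣ m3)
    (htamA : ¬ 3 ∣ A.tamagawaProduct)
    (hLA : ∃ q : ℚ, q ≠ 0 ∧ A.entireLFunction 1 / (A.realPeriodRat : ℂ) = (q : ℂ) ∧ padicValRat 3 q = 0)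
    (hSelA : Nat.card (A.selmerGroupPInfty 3) = 1)
    (hC1 : ∃ e : geomTorsion A ((3 : ℕ) : ℤ) ≃+ geomTorsion W ((3 : ℕ) : ℤ),
      ∀ (σ : Field.absoluteGaloisGroup ℚ) (P : geomTorsion A ((3 : ℕ) : ℤ)), e (σ • P) = σ • e P) :
    ∀ (κ : ZpExtension ℚ 3) (γ : Field.absoluteGaloisGroup ℚ),
        κ.IsCyclotomic → κ.IsTopGenerator γ → IsCyclotomicVariable 3 γ →
      ∀ [NeZero (W.conductorNorm ℤ)] (f : CuspForm (Gamma0 (W.conductorNorm ℤ)) 2),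
        IsNewformOf W f → ∀ (ϖ : ℚ), (ϖ : ℝ) * W.realPeriodRat = plusPeriod f →
      ∀ (D : W.SelmerDualData κ γ), D.IsTorsion ∧
        ∃ g : IwasawaAlgebra 3, D.charIdeal = Ideal.span {g} ∧
          GreenbergVatsal2000.HasUnitContent g ∧
          iwasawaToPowerSeries 3 g =
            PowerSeries.C (ϖ : ℚ_[3]) * padicLFunction f (unitRoot W 3 : ℚ_[3]) := by
  have hΔ : (⟨a1, a2, a3, a4, a6⟩ : WeierstrassCurve ℤ).Δ = discOf [a1, a2, a3, a4, a6] :=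
    intCurve_Δ a1 a2 a3 a4 a6
  have hΔA : (⟨b1, b2, b3, b4, b6⟩ : WeierstrassCurve ℤ).Δ = discOf [b1, b2, b3, b4, b6] :=
    intCurve_Δ b1 b2 b3 b4 b6
  have hgood : W.HasGoodReductionAtPrime 3 :=
    hasGoodReductionAtPrime_of_not_dvd W 3 (by rw [minimalDiscriminantInt_eq hW, hΔ]; exact h3Δ)
  have hord : ¬ ((3 : ℕ) : ℤ) ∣ W.frobeniusTrace 3 := by
    rw [frobeniusTrace_eq hW hcard3]; exact hord3
  have hgoodA : A.HasGoodReductionAtPrime 3 :=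
    hasGoodReductionAtPrime_of_not_dvd A 3 (by rw [minimalDiscriminantInt_eq hA, hΔA]; exact h3ΔA)
  have hordA : ¬ ((3 : ℕ) : ℤ) ∣ A.frobeniusTrace 3 := by
    rw [frobeniusTrace_eq hA hcard3A]; exact hord3A
  have hnaA : ¬ 3 ∣ A.reductionPointCount 3 := by
    rw [WeierstrassCurve.reductionPointCount, hA, hcard3A]; exact hna3A
  have hirr : W.HasIrreducibleModPGaloisRep 3 := by
    refine hasIrreducibleModPGaloisRep_of_intModel_of_noroot hW 3 ℓ hℓ3 (by rw [hΔ]; exact hℓΔ) hcard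
      (forall_zmod_of_forall_lt fun t ht h0 ↦ hnoroot t ht ?_)
    change ((3 : ℕ) : ℤ) ∣ _
    rw [← ZMod.intCast_zmod_eq_zero_iff_dvd]
    push_cast at h0 ⊢
    linear_combination h0
  obtain ⟨e, he⟩ := hC1
  have hirrA : A.HasIrreducibleModPGaloisRep 3 :=
    hasIrreducibleModPGaloisRep_of_torsionIso_symm e he hirr
  intro κ γ hκ hγ hγ'
  exact hGV A W 3 (by decide) hgoodA hordA hgood hord ⟨e, he⟩ hirrA hirr κ γ hκ hγ hγ'
    (mazurMainConjecture_with_mu_zero_of_trivialArithmetic_odd hkato hGr h5 h3 A 3 (by decide)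
      hgoodA hordA hirrA hnaA htamA hLA hSelA κ γ hκ hγ hγ')

/-- **Hence X_A3 at the pair, `MazurMainConjecture W 3`, for ANY cell congruent mod `3` to a curve
with trivial `3`-primary arithmetic** (unit-content clause dropped). Same hypotheses; per pair;
nothing booked. [cite: GreenbergVatsal2000, Thm. (1.4) (arXiv p. 5)] [cite: Kato2004Asterisque, Thm. 17.4 (1) (p. 273)]
[cite: CastellaGrossiSkinner2025, Introduction (MC)] -/
theorem mazurMainConjecture_three_of_ainvs_of_trivialPartner
    (hkato : ∀ (W : WeierstrassCurve ℚ) [W.IsElliptic] [W.IsGloballyMinimal] (p : ℕ) [Fact p.Prime]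
      (κ : ZpExtension ℚ p) (γ : Field.absoluteGaloisGroup ℚ) (N : ℕ) [NeZero N]
      (f : CuspForm (Gamma0 N) 2), kato_divisibility W p (κ := κ) (γ := γ) (f := f))
    (hGr : greenberg_charValue_rankZero) (h5 : realPeriodRat_eq_unit_mul_plusPeriod)
    (h3 : realPeriodRat_eq_unit_mul_plusPeriod_three)
    (hGV : GreenbergVatsal2000.thm14_mainConjecture_transfer_of_torsionIso)
    (a1 a2 a3 a4 a6 : ℤ) {W : WeierstrassCurve ℚ} [W.IsElliptic] [W.IsGloballyMinimal]
    (hW : integralModelInt W = ⟨a1, a2, a3, a4, a6⟩)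
    (b1 b2 b3 b4 b6 : ℤ) {A : WeierstrassCurve ℚ} [A.IsElliptic] [A.IsGloballyMinimal]
    (hA : integralModelInt A = ⟨b1, b2, b3, b4, b6⟩)
    [Fact (Nat.Prime 3)] (ℓ n n3 m3 : ℕ) [Fact ℓ.Prime]
    (h3Δ : ¬ (3 : ℤ) ∣ discOf [a1, a2, a3, a4, a6])
    (hcard3 : Nat.card (((⟨a1, a2, a3, a4, a6⟩ : WeierstrassCurve ℤ).map
      (Int.castRingHom (ZMod 3))).toAffine.Point) = n3)
    (hord3 : ¬ (3 : ℤ) ∣ (3 : ℤ) + 1 - n3)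
    (hℓ3 : ℓ ≠ 3) (hℓΔ : ¬ (ℓ : ℤ) ∣ discOf [a1, a2, a3, a4, a6])
    (hcard : Nat.card (((⟨a1, a2, a3, a4, a6⟩ : WeierstrassCurve ℤ).map
      (Int.castRingHom (ZMod ℓ))).toAffine.Point) = n)
    (hnoroot : ∀ t : ℕ, t < 3 → ¬ (3 : ℤ) ∣ (t : ℤ) ^ 2 - ((ℓ : ℤ) + 1 - n) * t + ℓ)
    (h3ΔA : ¬ (3 : ℤ) ∣ discOf [b1, b2, b3, b4, b6])
    (hcard3A : Nat.card (((⟨b1, b2, b3, b4, b6⟩ : WeierstrassCurve ℤ).map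
      (Int.castRingHom (ZMod 3))).toAffine.Point) = m3)
    (hord3A : ¬ (3 : ℤ) ∣ (3 : ℤ) + 1 - m3) (hna3A : ¬ 3 ∣ m3)
    (htamA : ¬ 3 ∣ A.tamagawaProduct)
    (hLA : ∃ q : ℚ, q ≠ 0 ∧ A.entireLFunction 1 / (A.realPeriodRat : ℂ) = (q : ℂ) ∧ padicValRat 3 q = 0)
    (hSelA : Nat.card (A.selmerGroupPInfty 3) = 1)
    (hC1 : ∃ e : geomTorsion A ((3 : ℕ) : ℤ) ≃+ geomTorsion W ((3 : ℕ) : ℤ),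
      ∀ (σ : Field.absoluteGaloisGroup ℚ) (P : geomTorsion A ((3 : ℕ) : ℤ)), e (σ • P) = σ • e P) :
    MazurMainConjecture W 3 := by
  intro κ γ hκ hγ hγ' _ f hf ϖ hϖ D
  obtain ⟨hT, g, hg, -, hι⟩ := mazurMainConjecture_three_unitContent_of_ainvs_of_trivialPartner
    hkato hGr h5 h3 hGV a1 a2 a3 a4 a6 hW b1 b2 b3 b4 b6 hA ℓ n n3 m3 h3Δ hcard3 hord3 hℓ3 hℓΔ hcard
    hnoroot h3ΔA hcard3A hord3A hna3A htamA hLA hSelA hC1 κ γ hκ hγ hγ' f hf ϖ hϖ D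
  exact ⟨hT, g, hg, hι⟩

end Summit.BirchSwinnertonDyer.Rank1Residual.X10.UnitRoad
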